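import Summits.BirchSwinnertonDyer.BirchSwinnertonDyer.Theorems.ResidualThetaTransportAtTwoSignedMuVanishingAtTwoPlusSel2
import Summits.BirchSwinnertonDyer.BirchSwinnertonDyer.Theorems.ResidualThetaTransportAtTwoSignedMuSeedAtTwoPlusSplitFiniteness
import Literature.NumberTheory.EllipticCurves.Kato2004.EulerSystemBoundFineSelmerTwo
import Literature.NumberTheory.EllipticCurves.Kato2004.IwasawaCohomologyExistsProofs
import Literature.NumberTheory.EllipticCurves.TateModuleContinuityProofs
import Literature.NumberTheory.EllipticCurves.TateModuleFreeProofs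
import HarnessLib

/-!
# Seed crux `SignedMuSeedAtTwoPlus` (stmt-BirchSwinnertonDyer-21438) — line `kolyvagin-char-two`
# «Mazur–Rubin rigidity at the BLIND-SPOT PRIME `2Λ` for `p = 2`: Kato's class mod 2 is a Kolyvagin system over
#  `Ω = 𝔽₂⟦T⟧`; if it is non-zero, `Sel₀(ℚ_∞, W[2])` is finite» — the fine half (F) becomes a THEOREM-SHAPED
#  consequence of FLAT (sibling crux 21437), with no class numbers, no member hunt, no signed Coleman map at 2

Crux-ideate r1 k2 g6 (planner `planner-cruxidea-stmt-BirchSwinnertonDyer-21438-2-g6-0`), route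
`ResidualThetaTransportAtTwo` (closes the rung leaf `WAllNonCMAtTwoThetaHabitatPlus`, NOT BSD; BSD is not proved
here or anywhere in this tree).

## Idea (one paragraph)

Every line of record for this crux (`fine-plus-split`, `sign-dichotomy`, `theta-symbol-seed`, `pt-trivial-half`)
splits `Sel⁺(W/ℚ_∞)[2]` finite into a PLUS-LOCAL half (port of Kobayashi/Kim–Kurihara at 2, fed by FLAT) and a
FINE half (F) `μ(X₀(W/ℚ_∞)) = 0`, and every one of them discharges (F) through a CLASS-NUMBER DOOR (Lim–Murty /
Fukuda on the `S₃`-sextic `ℚ(W[2])`: certified on 87/153 habitat classes, kit j300502) — i.e. through an instance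
of Iwasawa's `μ = 0` conjecture for which no theorem-shaped tool exists.  THIS line replaces the door by the
`GL₂` Euler system itself: Kato's integral `Λ`-adic zeta class `s ∈ 𝐇¹_Γ(T₂W)` (tree `IsEulerSystemClassTwo`),
reduced modulo `2`, is a Kolyvagin system for the residual family `T̄ ⊗ Ω/T^k` (`T̄ = W[2]`,
`Ω = Λ/2Λ = 𝔽₂⟦T⟧` = Mazur–Rubin's localisation `S_𝔓` at the height-one prime `𝔓 = 2Λ`), and Mazur–Rubin's
Theorem 5.3.10 read AT `𝔓 = pΛ` says: if `𝔓` is not a BLIND SPOT (`s ∉ 2𝐇¹`) then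
`μ(X₀) = μ(𝐇¹/Λs)`; in particular `Sel₀(ℚ_∞, W[2])` is finite, which is `FineResidualFinite`.  In print
this needs `p ≥ 5` ONLY for the Chebotarev «useful prime» selection (C.-H. Kim, AJM, arXiv:2203.12159
p. 5; Sakamoto, Doc. Math. 27 (2022) App. §5 did `p = 3`).  On the theta-habitat the residual hypotheses come
for free and are BETTER than generic: good supersingular at 2 ⇒ `ρ̄_{W,2}(G_ℚ) = GL₂(𝔽₂) ≅ S₃` (absolutely
irreducible, `H¹(S₃, 𝔽₂²) = 0`, a transposition `τ` with `T̄/(τ−1)T̄` of rank one — no 2-adic big-image input);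
`2` inert in `ℚ(√Δ)` ⇒ `ℚ(W[2]) ∩ ℚ(μ_{2^∞}) = ℚ`; `Δ < 0` ⇒ `T₂W ≅ ℤ₂[Gal(ℂ/ℝ)]` is cohomologically trivial
at `∞` (residual core rank `χ(T̄) = 2 − 1 = 1`, Poitou–Tate exact at 2, the archimedean 2-defect that breaks
`Δ > 0` is absent); characteristic-2 coefficients ⇒ `I_ℓ = 0` for every Kolyvagin prime.  The ONE new input
(stub S2's heart): for `S₃ ↷ 𝔽₂²` any TWO non-zero classes admit a common useful prime (distinct classes have
distinct index-2 kernels, two proper cosets never cover `G_F`) while THREE dependent ones may not (the three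
affine lines `x = a`, `y = b`, `x + y = a + b` cover `𝔽₂²`, checked below by `decide`) — so Mazur–Rubin §4.3–4.5
must be re-run with two simultaneous Chebotarev conditions (Sakamoto needed three at `p = 3`).
Detection (stub S3): FLAT `μ(ϖ_W L♭_W) = 0` ⇒ some genuine class `s` is NOT divisible by `2` (Otsuki 2009:
the integral finite-layer Coleman map sends Kato's `z_N` to the Néron-normalised `θ_N(W)`; `s = 2y` would force
`θ_N ≡ 0 (mod 2)` for all `N`, contradicting `μ(θ_N) = μ(ϖL♭) = 0` for `N ≫ 0` even).

## Registered stubs (the ONLY `sorry`s): S1 `stub_flatPlusLocalHalfAtTwo` (VERBATIM the shared plus-local port of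
`pt_trivial_half` / `fine-plus-split` (c)), S2 `stub_katoBlindSpotBoundAtTwo` (THE LEVER, new), S3
`stub_flatDetectsKatoClassModTwo` (new), S4 `stub_analyticSupplyAtTwo` (VERBATIM shared), S5 `stub_flatAtTwo`
(= sibling crux 21437 BY NAME).  Composition `SignedMuSeedAtTwoPlus_of` concludes the crux BY NAME with `A := W`.
-/

open WeierstrassCurve Literature.NumberTheory.EllipticCurves
open Literature.NumberTheory.EllipticCurves.Kobayashi2003
open Literature.NumberTheory.EllipticCurves.Rank1Residual
open Literature.NumberTheory.EllipticCurves.ModularForms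
open Summit.BirchSwinnertonDyer.Rank1Residual.Supersingular Summit.BirchSwinnertonDyer.Rank1Residual.X1
open Summit.BirchSwinnertonDyer.BirchSwinnertonDyer.Theses.ResidualThetaTransportAtTwo
open scoped MatrixGroups ModularForm
open CongruenceSubgroup

-- the Cruxes namespace of this sub repeats the summit name by design (D-0017 nested layout)
set_option linter.dupNamespace false

noncomputable section

namespace Summit.BirchSwinnertonDyer.BirchSwinnertonDyer.Cruxes.SignedMuSeedAtTwoPlus.KolyvaginCharTwo

/-! ## Vocabulary (over existing declarations; VERBATIM the currencies of the sibling lines) -/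

/-- `Sel₀(ℚ_∞, W[2^∞])[2]` is finite (residual Conjecture A at `(W, 2)`; VERBATIM `pt_trivial_half` /
`sign-dichotomy`).  Equivalent to `μ(X₀(W/ℚ_∞)) = 0` for every finitely generated pinned fine dual
(`IwasawaModuleFinitePadicInt.exists_fineSelmerDualData_moduleFinite_iff_finite_pTorsion`). -/
def FineResidualFinite (W : WeierstrassCurve ℚ) [W.IsElliptic] (κ : ZpExtension ℚ 2) : Prop :=
  {s : W.fineSelmerInfty κ | 2 • s = 0}.Finite

/-- The PLUS-LOCAL HALF at `κ` (VERBATIM `pt_trivial_half` / `fine-plus-split`): the image of `Sel⁺[2]` in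
`H¹/Sel₀` is finite. -/
def PlusLocalHalf (W : WeierstrassCurve ℚ) [W.IsElliptic] (κ : ZpExtension ℚ 2) : Prop :=
  ((QuotientAddGroup.mk' (W.fineSelmerInfty κ)) ''
    {x : W.subgroupH1 2 κ.kerSubgroup | x ∈ signedSelmerInfty W κ 1 ∧ 2 • x = 0}).Finite

/-! ## Registered stub statements -/

/-- **S1 (shared, VERBATIM `pt_trivial_half.FlatPlusLocalHalfAtTwo`).** FLAT in scalar form ⇒ the plus-local
half at every cyclotomic `κ`.  Port of Kobayashi 2003 Thm 1.2/§8–9 + B.D. Kim 2009 Thm 1.1/1.3 to `p = 2`,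
`a₂ = 0` (inside `SignedIwasawaTheoryAtTwoBarrier`'s technique class; shared with every sibling line). -/
def FlatPlusLocalHalfAtTwo : Prop :=
  ∀ (W : WeierstrassCurve ℚ) [W.IsElliptic] [W.IsGloballyMinimal], ¬ W.HasCM → W.analyticRank = 0 →
    GoodSS W 2 → W.frobeniusTrace 2 = 0 → W.Δ < 0 →
    ∀ [NeZero (W.conductorNorm ℤ)] (f : CuspForm (Gamma0 (W.conductorNorm ℤ)) 2), IsNewformOf W f →
    ∀ (ϖ : ℚ), (ϖ : ℝ) * W.realPeriodRat = plusPeriod f →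
    ∀ (Lplus Lminus : IwasawaAlgebra 2), IsPollackPair f 2 Lplus Lminus →
    padicValRat 2 ϖ + MuLambda.mu Lminus = 0 →
    ∀ (κ : ZpExtension ℚ 2), κ.IsCyclotomic → PlusLocalHalf W κ

/-- **S2 — THE LEVER (new): Mazur–Rubin Theorem 5.3.10 at the blind-spot prime `𝔓 = 2Λ`, `p = 2`, on the
theta-habitat.**  For a habitat⁺ curve `W` (non-CM, `r_an = 0`, good supersingular at 2 with `a₂ = 0`, `Δ < 0`)
and ANY genuine integral `Λ`-adic Euler-system class `s ∈ 𝐇¹_Γ(T₂W)` along a cyclotomic `κ`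
(`Kato2004.IsEulerSystemClassTwo`), if `s ∉ 2·𝐇¹` (the prime `2Λ` is not a blind spot of the Kolyvagin system
of `s`) then `Sel₀(ℚ_∞, W[2^∞])[2]` is finite.  Mechanism: `s mod 2` ↦ a Kolyvagin system for `W[2] ⊗ 𝔽₂⟦T⟧/T^k`
(all `k`) with the `2`-relaxed structure; `κ̄₁ ≠ 0` + core rank one ⇒ `Sel₀(ℚ_∞, W[2])` has finite `Ω`-length
(Rubin PCMS Cor 3.2.9 (2) shape over the DVR `Ω`).  In print for `p ≥ 5`, `ρ̄` surjective (Kim 2022 Thm 4.7 =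
MR04 Thm 5.3.10, `ord_{pΛ}` = `μ`); NOT in print at `p = 2` ((H.4) «`T̄ ≇ T̄*` or `p ≥ 5`» fails: Weil pairing). -/
def KatoBlindSpotBoundAtTwo : Prop :=
  ∀ (W : WeierstrassCurve ℚ) [W.IsElliptic] [W.IsGloballyMinimal], ¬ W.HasCM → W.analyticRank = 0 →
    GoodSS W 2 → W.frobeniusTrace 2 = 0 → W.Δ < 0 →
    ∀ [ContinuousSMul ℤ_[2] (W.tateModule 2)] [Module.Free ℤ_[2] (W.tateModule 2)]
      [Module.Finite ℤ_[2] (W.tateModule 2)]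
      (κ : ZpExtension ℚ 2) (γ : Field.absoluteGaloisGroup ℚ) (hκ : κ.IsCyclotomic), κ.IsTopGenerator γ →
    ∀ (I : Kato2004.IwasawaH1Data W 2 κ γ) (s : I.H), Kato2004.IsEulerSystemClassTwo W hκ I s →
      (¬ ∃ y : I.H, s = (2 : IwasawaAlgebra 2) • y) → FineResidualFinite W κ

/-- **S3 (new): FLAT detects Kato's class modulo 2.**  On the habitat, FLAT in scalar form
(`v₂(ϖ_W) + μ(L⁻) = 0`, the content of the sibling crux 21437) implies that the pinned `𝐇¹_Γ(T₂W)` along every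
cyclotomic `κ` carries a genuine integral Euler-system class NOT divisible by `2`.  Mechanism: Kato's `z^{(2)}`
(tree `exists_isEulerSystemClassTwo_ne_zero_of_goodSS` gives a genuine non-zero class) and Otsuki's integral
finite-layer Coleman maps at `p = 2` (`P_N(z_N) = θ_N(W)` Néron-normalised; Otsuki 2009 Thm 3.6/4.1,
Kurihara–Otsuki 2006 p. 564 for integrality of `z` on the `ℤ₂`-tower): `s = 2y` would give `2 ∣ θ_N(W)` in
`ℤ₂[G_N]` for all `N`, while FLAT gives `μ(θ_N) = v₂(ϖ) + μ(L♭) = 0` for `N ≫ 0` (tree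
`ThetaMuControlOfPollackPair`).  Existential in `s` on purpose: `2z` is also a genuine class, so «every genuine
class is non-divisible» is false. -/
def FlatDetectsKatoClassModTwo : Prop :=
  ∀ (W : WeierstrassCurve ℚ) [W.IsElliptic] [W.IsGloballyMinimal], ¬ W.HasCM → W.analyticRank = 0 →
    GoodSS W 2 → W.frobeniusTrace 2 = 0 → W.Δ < 0 →
    ∀ [NeZero (W.conductorNorm ℤ)] (f : CuspForm (Gamma0 (W.conductorNorm ℤ)) 2), IsNewformOf W f →
    ∀ (ϖ : ℚ), (ϖ : ℝ) * W.realPeriodRat = plusPeriod f →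
    ∀ (Lplus Lminus : IwasawaAlgebra 2), IsPollackPair f 2 Lplus Lminus →
    padicValRat 2 ϖ + MuLambda.mu Lminus = 0 →
    ∀ [ContinuousSMul ℤ_[2] (W.tateModule 2)] [Module.Free ℤ_[2] (W.tateModule 2)]
      [Module.Finite ℤ_[2] (W.tateModule 2)]
      (κ : ZpExtension ℚ 2) (γ : Field.absoluteGaloisGroup ℚ) (hκ : κ.IsCyclotomic), κ.IsTopGenerator γ →
    ∀ (I : Kato2004.IwasawaH1Data W 2 κ γ),
      ∃ s : I.H, Kato2004.IsEulerSystemClassTwo W hκ I s ∧ ¬ ∃ y : I.H, s = (2 : IwasawaAlgebra 2) • y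

/-- **S4 (shared, VERBATIM `pt_trivial_half.AnalyticSupplyAtTwo`).** The analytic data of a good-supersingular
`a₂ = 0` curve exist: newform, rational period unit `ϖ_W`, a Pollack pair at `2` (modularity + Manin–Drinfeld +
Pollack 2003 Thm 5.6/Cor 5.11 typed at `p = 2`). -/
def AnalyticSupplyAtTwo : Prop :=
  ∀ (W : WeierstrassCurve ℚ) [W.IsElliptic] [W.IsGloballyMinimal], GoodSS W 2 → W.frobeniusTrace 2 = 0 →
    ∃ (_ : NeZero (W.conductorNorm ℤ)) (f : CuspForm (Gamma0 (W.conductorNorm ℤ)) 2) (ϖ : ℚ)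
      (Lplus Lminus : IwasawaAlgebra 2),
      IsNewformOf W f ∧ (ϖ : ℝ) * W.realPeriodRat = plusPeriod f ∧ IsPollackPair f 2 Lplus Lminus

/-! ## The stubs (the ONLY `sorry`s of this file) -/

/-- S1 · shared plus-local port (size L; `SignedIwasawaTheoryAtTwoBarrier` class, honest). -/
theorem stub_flatPlusLocalHalfAtTwo : FlatPlusLocalHalfAtTwo := by
  sorry

/-- S2 · THE LEVER: MR 5.3.10 at `𝔓 = 2Λ`, `p = 2`, habitat residual type `S₃`, `Δ < 0` (size XL; hardest). -/
theorem stub_katoBlindSpotBoundAtTwo : KatoBlindSpotBoundAtTwo := by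
  sorry

/-- S3 · FLAT ⇒ a genuine Kato class not divisible by 2 (size L; Otsuki's integral `P_N` at `p = 2`). -/
theorem stub_flatDetectsKatoClassModTwo : FlatDetectsKatoClassModTwo := by
  sorry

/-- S4 · shared analytic supply (size M). -/
theorem stub_analyticSupplyAtTwo : AnalyticSupplyAtTwo := by
  sorry

/-- S5 · FLAT = the SIBLING CRUX 21437 by name (its own seats; not this line's work). -/
theorem stub_flatAtTwo : SignedMuAnalyticAtTwoPlus := by
  sorry

/-! ## In-Lean check of the `p = 2` Chebotarev combinatorics (the located obstruction and its evasion)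

Classes `c ∈ H¹(F, T̄) = Hom(G_F, 𝔽₂²)` restricted to `G_F` (`F = ℚ(W[2], μ_{2^{j+2}})`); a Kolyvagin prime with
Frobenius `τ·g` is USEFUL for `c` iff `c(g) ∉ (coset determined by c(τ))` of the line `(τ − 1)T̄`; in coordinates
`G_F ↠ 𝔽₂²`, «useless for c» is ONE affine line.  Two classes: two affine lines never cover `𝔽₂²` (first
`example`); three dependent classes `x`, `y`, `x + y`: the three affine lines CAN cover (second `example`) — the
exact point where Mazur–Rubin's (H.4)/`p ≥ 5` (and Sakamoto's `p = 3` three-class Lemma 5.1) is used. -/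

example : ∀ a b : ZMod 2, ∃ x y : ZMod 2, x ≠ a ∧ y ≠ b := by decide

example : ∀ a b x y : ZMod 2, x = a ∨ y = b ∨ x + y = a + b := by decide

-- … but only for the ONE bad value of the third condition; with the other value the three are jointly avoidable:
example : ∀ a b : ZMod 2, ∃ x y : ZMod 2, x ≠ a ∧ y ≠ b ∧ x + y ≠ a + b + 1 := by decide

/-! ## Glue (sorry-free given the stubs) -/

/-- (F) from FLAT: S3 supplies a genuine class not divisible by `2` in the pinned `𝐇¹_Γ(T₂W)` along `κ'`
(which exists: `Kato2004.nonempty_iwasawaH1Data_holds`; instances from the tree's `_holds` companions), S2 turns it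
into `FineResidualFinite W κ'`. -/
theorem fineResidualFinite_of_flat (h2 : KatoBlindSpotBoundAtTwo) (h3 : FlatDetectsKatoClassModTwo)
    (W : WeierstrassCurve ℚ) [W.IsElliptic] [W.IsGloballyMinimal] (hCM : ¬ W.HasCM) (hr : W.analyticRank = 0)
    (hss : GoodSS W 2) (ha : W.frobeniusTrace 2 = 0) (hΔ : W.Δ < 0) [NeZero (W.conductorNorm ℤ)]
    (f : CuspForm (Gamma0 (W.conductorNorm ℤ)) 2) (hf : IsNewformOf W f) (ϖ : ℚ)
    (hϖ : (ϖ : ℝ) * W.realPeriodRat = plusPeriod f) (Lplus Lminus : IwasawaAlgebra 2)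
    (hP : IsPollackPair f 2 Lplus Lminus) (hflat : padicValRat 2 ϖ + MuLambda.mu Lminus = 0)
    (κ' : ZpExtension ℚ 2) (hκ' : κ'.IsCyclotomic) : FineResidualFinite W κ' := by
  haveI : ContinuousSMul ℤ_[2] (W.tateModule 2) := TateModule.continuousSMul_padicInt
  haveI : Module.Free ℤ_[2] (W.tateModule 2) := W.module_free_tateModule_holds 2
  haveI : Module.Finite ℤ_[2] (W.tateModule 2) := W.module_finite_tateModule_holds 2
  obtain ⟨γ₀, hγ₀⟩ : ∃ γ₀ : Field.absoluteGaloisGroup ℚ, κ'.IsTopGenerator γ₀ :=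
    κ'.surjective (Multiplicative.ofAdd 1)
  obtain ⟨I⟩ := Kato2004.nonempty_iwasawaH1Data_holds W 2 κ' γ₀ hκ' hγ₀
  obtain ⟨s, hs, hndiv⟩ := h3 W hCM hr hss ha hΔ f hf ϖ hϖ Lplus Lminus hP hflat κ' γ₀ hκ' hγ₀ I
  exact h2 W hCM hr hss ha hΔ κ' γ₀ hκ' hγ₀ I s hs hndiv

/-- `Sel⁺(W/ℚ_∞)[2]` finite from S1 (plus-local half), (F) (supplied by `fineResidualFinite_of_flat`) and the
LANDED split `Theorems.SignedMuAtTwo.FineSplit.splitFiniteness` (p596845) — VERBATIM the glue of `pt_trivial_half`. -/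
theorem sel2Finite_of_flat (h1 : FlatPlusLocalHalfAtTwo) (W : WeierstrassCurve ℚ) [W.IsElliptic]
    [W.IsGloballyMinimal] (hCM : ¬ W.HasCM) (hr : W.analyticRank = 0) (hss : GoodSS W 2)
    (ha : W.frobeniusTrace 2 = 0) (hΔ : W.Δ < 0) [NeZero (W.conductorNorm ℤ)]
    (f : CuspForm (Gamma0 (W.conductorNorm ℤ)) 2) (hf : IsNewformOf W f) (ϖ : ℚ)
    (hϖ : (ϖ : ℝ) * W.realPeriodRat = plusPeriod f) (Lplus Lminus : IwasawaAlgebra 2)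
    (hP : IsPollackPair f 2 Lplus Lminus) (hflat : padicValRat 2 ϖ + MuLambda.mu Lminus = 0)
    (hF : ∀ κ' : ZpExtension ℚ 2, κ'.IsCyclotomic → FineResidualFinite W κ')
    (κ : ZpExtension ℚ 2) (γ : Field.absoluteGaloisGroup ℚ) (hκ : κ.IsCyclotomic) (hγ : κ.IsTopGenerator γ) :
    {s : signedSelmerInfty W κ 1 | 2 • s = 0}.Finite := by
  refine Theorems.SignedMuAtTwo.FineSplit.splitFiniteness W κ γ hκ hγ (fun κ' hκ' ↦ ?_)
    (h1 W hCM hr hss ha hΔ f hf ϖ hϖ Lplus Lminus hP hflat κ hκ)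
  obtain ⟨γ₀, hγ₀⟩ : ∃ γ₀ : Field.absoluteGaloisGroup ℚ, κ'.IsTopGenerator γ₀ :=
    κ'.surjective (Multiplicative.ofAdd 1)
  exact (IwasawaModuleFinitePadicInt.exists_fineSelmerDualData_moduleFinite_iff_finite_pTorsion W κ' hγ₀).mpr
    (hF κ' hκ')

/-! ## The skeleton theorem (registrar shape: the ONLY theorem of this file concluding the crux) -/

/-- **THE SKELETON THEOREM: the crux BY NAME from the five declared stubs (the only `sorry`s in its closure are
`stub_flatPlusLocalHalfAtTwo`, `stub_katoBlindSpotBoundAtTwo`, `stub_flatDetectsKatoClassModTwo`,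
`stub_analyticSupplyAtTwo`, `stub_flatAtTwo`).** `A := W`, `e := AddEquiv.refl`: analytic data from S4; FLAT in
scalar form from the SIBLING CRUX 21437 (S5) through `signedMuAnalyticAtTwoPlus_iff_padicValRat_add_mu_eq_zero`;
(F) from S3 + S2 (`fineResidualFinite_of_flat`) — NO class-number door, NO member hunt; `Sel⁺[2]` finite by S1 +
the landed split; the SEL2 door `isTorsion_and_mu_eq_zero_iff_finite_selmer_pTorsion` (p580570) finishes. -/
theorem SignedMuSeedAtTwoPlus_of :
    Summit.BirchSwinnertonDyer.BirchSwinnertonDyer.Theses.ResidualThetaTransportAtTwo.SignedMuSeedAtTwoPlus := by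
  intro W _ _ hCM hr hss ha hΔ
  refine ⟨W, ‹_›, ‹_›, hss, ha, ⟨AddEquiv.refl _, fun σ P ↦ rfl⟩, fun κ γ hκ hγ D _ ↦ ?_⟩
  obtain ⟨hN, f, ϖ, Lplus, Lminus, hf, hϖ, hP⟩ := stub_analyticSupplyAtTwo W hss ha
  have hflat : padicValRat 2 ϖ + MuLambda.mu Lminus = 0 :=
    (Theorems.SignedMuAtTwo.signedMuAnalyticAtTwoPlus_iff_padicValRat_add_mu_eq_zero.mp stub_flatAtTwo)
      W hCM hr hss ha hΔ f hf ϖ hϖ Lplus Lminus hP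
  have hfin : {s : signedSelmerInfty W κ 1 | 2 • s = 0}.Finite :=
    sel2Finite_of_flat stub_flatPlusLocalHalfAtTwo W hCM hr hss ha hΔ f hf ϖ hϖ Lplus Lminus hP hflat
      (fun κ' hκ' ↦ fineResidualFinite_of_flat stub_katoBlindSpotBoundAtTwo stub_flatDetectsKatoClassModTwo
        W hCM hr hss ha hΔ f hf ϖ hϖ Lplus Lminus hP hflat κ' hκ') κ γ hκ hγ
  exact (Theorems.SignedMuAtTwo.isTorsion_and_mu_eq_zero_iff_finite_selmer_pTorsion D).mpr hfin

end Summit.BirchSwinnertonDyer.BirchSwinnertonDyer.Cruxes.SignedMuSeedAtTwoPlus.KolyvaginCharTwo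

end
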